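import Summits.MatrixMultiplication.OmegaCensus.STPPKernelListerInv

/-!
# ω-census (abelian STPP census): kernel lister — leaf soundness, part 1: role images, block permutations and the canonical dead test (kernel)

HONEST FRAMING (pub-omega census; verbatim): lottery ticket; floor = certified bounds/negative ranges.
Census STRUCTURE (seat pub-omega-stpp-2 gen 29, 2026-08-29), family (b2).  Nothing here is progress on `ω`.

Realisability of a size pattern is invariant under the two role maps `rotP` (`(a,b,c) ↦ (b,c,a)`, `stpp_rotate`) and `revP` (`(a,b,c) ↦ (c,b,a)`,
`isSTPP_neg_reverse`), hence under all six role images, and under every permutation of the blocks (reindexing an STPP family by an injection,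
`isSTPP_subfamily`; the index map is extracted from `List.Perm` by `exists_index_map_of_perm`).  Consequently the lister's dead test is sound:
`isDead dead P = true` (the canonical form `canonP P` — the least sorted role image — is listed) and `∀ D ∈ dead, ¬ Realizable H D` give `¬ Realizable H P`
(`not_realizable_of_isDead`).  Also here: the non-minimal branch and the two cheap filters of `leafOK` (`repDead`, `n16DeadL`) exclude realisable minimal
beating patterns.  The Kneser-type filters `n8DeadL`, `n18DeadL`, `n12DeadL` (bridges to `STPPKneser.N8Dead`, `CubeNB.N18Dead`, `CubeNB.N12Dead`) are
part 2 (successor; spec HOME `pub-omega-stpp-2-g29/CAPSTONE-REDESIGN-SPEC.md`).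
-/

open Finset
open scoped Pointwise

namespace Summit.MatrixMultiplication.OmegaCensus.KLister

open Literature.Computability.AlgebraicComplexity

section Symmetry

variable {H : Type*} [AddCommGroup H]

/-! ## Reindexing -/

/-- Realisability along an index map: if `Q` is realised and `σ` is an injection of positions of `P` into positions of `Q` with `Q[σ i] = P[i]`,
then `P` is realised. [folklore] -/
theorem Realizable.of_index_map {P Q : List Shape} (hQ : Realizable H Q) (σ : Fin P.length → Fin Q.length) (hσ : Function.Injective σ)
    (hget : ∀ i, Q.get (σ i) = P.get i) : Realizable H P := by
  obtain ⟨A, B, C, hS, hc⟩ := hQ.out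
  refine ⟨⟨fun i => A (σ i), fun i => B (σ i), fun i => C (σ i), isSTPP_subfamily hS σ hσ, fun i => ?_⟩⟩
  obtain ⟨h1, h2, h3, h4, h5, h6⟩ := hc (σ i)
  rw [hget i] at h4 h5 h6
  exact ⟨h1, h2, h3, h4, h5, h6⟩

/-- From a permutation of lists, an injective index map matching entries. [folklore] -/
theorem exists_index_map_of_perm {P Q : List Shape} (h : P.Perm Q) :
    ∃ σ : Fin P.length → Fin Q.length, Function.Injective σ ∧ ∀ i, Q.get (σ i) = P.get i := by
  induction h with
  | nil => exact ⟨id, fun _ _ h => h, fun i => i.elim0⟩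
  | @cons x l₁ l₂ _ ih =>
    obtain ⟨σ, hσ, hget⟩ := ih
    refine ⟨fun i => Fin.cases ⟨0, by simp⟩ (fun j => ⟨(σ j).val + 1, by simp [(σ j).isLt]⟩) i, ?_, ?_⟩
    · intro i j hij
      cases i using Fin.cases with
      | zero =>
        cases j using Fin.cases with
        | zero => rfl
        | succ j => simp [Fin.ext_iff] at hij
      | succ i =>
        cases j using Fin.cases with
        | zero => simp [Fin.ext_iff] at hij
        | succ j =>
          have : σ i = σ j := Fin.ext (by simpa [Fin.ext_iff] using hij)
          rw [hσ this]
    · intro i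
      cases i using Fin.cases with
      | zero => rfl
      | succ j =>
        have := hget j
        simp only [Fin.cases_succ, List.get_eq_getElem, List.getElem_cons_succ, List.length_cons, Fin.val_succ] at this ⊢
        exact this
  | swap x y l =>
    refine ⟨fun i => ⟨if i.val = 0 then 1 else if i.val = 1 then 0 else i.val, by
        have := i.isLt; simp only [List.length_cons] at this ⊢; split_ifs <;> omega⟩, ?_, ?_⟩
    · intro i j hij
      simp only [Fin.ext_iff] at hij
      apply Fin.ext
      split_ifs at hij <;> omega
    · intro i
      obtain ⟨i, hi⟩ := i
      simp only [List.get_eq_getElem]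
      match i, hi with
      | 0, _ => simp
      | 1, _ => simp
      | k + 2, hk => simp
  | trans _ _ ih1 ih2 =>
    obtain ⟨σ, hσ, h1⟩ := ih1
    obtain ⟨τ, hτ, h2⟩ := ih2
    exact ⟨τ ∘ σ, hτ.comp hσ, fun i => by rw [Function.comp_apply, h2, h1]⟩

/-- **Realisability is invariant under permutations of the blocks.** [folklore] -/
theorem Realizable.perm {P Q : List Shape} (hQ : Realizable H Q) (h : P.Perm Q) : Realizable H P := by
  obtain ⟨σ, hσ, hget⟩ := exists_index_map_of_perm h
  exact hQ.of_index_map σ hσ hget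

/-! ## Role images -/

/-- Positions of a mapped list. [folklore] -/
theorem get_map' (f : Shape → Shape) (P : List Shape) (i : Fin (P.map f).length) :
    (P.map f).get i = f (P.get (Fin.cast (by simp) i)) := by
  simp [List.get_eq_getElem]

/-- **`rotP` preserves realisability** (`(A,B,C) ↦ (B,C,A)`). [folklore] -/
theorem Realizable.rot {P : List Shape} (h : Realizable H P) : Realizable H (KLister.rotP P) := by
  obtain ⟨A, B, C, hS, hc⟩ := h.out
  let κ : Fin (rotP P).length → Fin P.length := Fin.cast (by simp [KLister.rotP])
  have hκ : Function.Injective κ := fun i j hij => by simpa [κ, Fin.ext_iff] using hij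
  refine ⟨⟨fun i => B (κ i), fun i => C (κ i), fun i => A (κ i), isSTPP_subfamily (stpp_rotate hS) κ hκ, fun i => ?_⟩⟩
  obtain ⟨h1, h2, h3, h4, h5, h6⟩ := hc (κ i)
  have e : (KLister.rotP P).get i = ((P.get (κ i)).2.1, (P.get (κ i)).2.2, (P.get (κ i)).1) := get_map' _ P i
  rw [e]
  exact ⟨h2, h3, h1, h5, h6, h4⟩

/-- **`revP` preserves realisability** (`(A,B,C) ↦ (−C,−B,−A)`). [folklore] -/
theorem Realizable.rev [DecidableEq H] {P : List Shape} (h : Realizable H P) : Realizable H (KLister.revP P) := by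
  obtain ⟨A, B, C, hS, hc⟩ := h.out
  let κ : Fin (revP P).length → Fin P.length := Fin.cast (by simp [KLister.revP])
  have hκ : Function.Injective κ := fun i j hij => by simpa [κ, Fin.ext_iff] using hij
  have hS' := isSTPP_neg_reverse (isSTPP_subfamily hS κ hκ)
  refine ⟨⟨fun i => -(C (κ i)), fun i => -(B (κ i)), fun i => -(A (κ i)), hS', fun i => ?_⟩⟩
  obtain ⟨h1, h2, h3, h4, h5, h6⟩ := hc (κ i)
  have e : (KLister.revP P).get i = ((P.get (κ i)).2.2, (P.get (κ i)).2.1, (P.get (κ i)).1) := get_map' _ P i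
  rw [e]
  refine ⟨h3.neg, h2.neg, h1.neg, ?_, ?_, ?_⟩ <;> simp [Finset.card_neg, h4, h5, h6]

/-- Every sorted role image listed in `roleImagesP P` is realisable if `P` is. [folklore] -/
theorem Realizable.of_mem_roleImagesP [DecidableEq H] {P Q : List Shape} (h : Realizable H P) (hQ : Q ∈ roleImagesP P) : Realizable H Q := by
  simp only [roleImagesP, List.mem_cons, List.not_mem_nil, or_false] at hQ
  rcases hQ with rfl | rfl | rfl | rfl | rfl | rfl
  · exact h
  · exact h.rot
  · exact h.rot.rot
  · exact h.rev
  · exact h.rot.rot.rev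
  · exact h.rot.rev

/-! ## The canonical form -/

/-- The canonical form is the sorted form of one of the six role images. [folklore] -/
theorem canonP_mem (P : List Shape) : ∃ Q ∈ roleImagesP P, canonP P = sortP Q := by
  unfold canonP
  -- the fold keeps an element of the candidate list (or the seed `sortP P`, itself the first candidate)
  have key : ∀ (L : List (List Shape)) (acc : List Shape), (∃ Q ∈ roleImagesP P, acc = sortP Q) → (∀ X ∈ L, ∃ Q ∈ roleImagesP P, X = sortP Q) →
      ∃ Q ∈ roleImagesP P, L.foldl (fun acc Q => if ltP Q acc then Q else acc) acc = sortP Q := by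
    intro L
    induction L with
    | nil => intro acc hacc _; simpa using hacc
    | cons X L ih =>
      intro acc hacc hL
      rw [List.foldl_cons]
      refine ih _ ?_ (fun Y hY => hL Y (List.mem_cons_of_mem _ hY))
      split_ifs
      · exact hL X List.mem_cons_self
      · exact hacc
  refine key _ _ ⟨P, by simp [roleImagesP], rfl⟩ (fun X hX => ?_)
  obtain ⟨Q, hQ, rfl⟩ := List.mem_map.1 hX
  exact ⟨Q, hQ, rfl⟩

/-- The canonical form is realisable if `P` is. [folklore] -/
theorem Realizable.canonP [DecidableEq H] {P : List Shape} (h : Realizable H P) : Realizable H (canonP P) := by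
  obtain ⟨Q, hQ, e⟩ := canonP_mem P
  rw [e]
  exact (h.of_mem_roleImagesP hQ).perm (List.perm_insertionSort _ Q)

/-- **Soundness of the dead test**: a pattern whose canonical form is a listed dead (= non-realisable) pattern is not realisable. [folklore] -/
theorem not_realizable_of_isDead [DecidableEq H] {dead : List (List Shape)} (hdead : ∀ D ∈ dead, ¬ Realizable H D) {P : List Shape}
    (h : isDead dead P = true) : ¬ Realizable H P := by
  intro hP
  rw [isDead, List.contains_iff_mem] at h
  exact hdead _ h hP.canonP

end Symmetry

/-! ## The cheap leaf filters -/

section Filters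

variable {H : Type*} [AddCommGroup H] [Fintype H] {n : ℕ}

/-- **`repDead` is sound**: a realisable pattern is not representation-count dead. [folklore] -/
theorem not_repDead (hn : Fintype.card H = n) {P : List Shape} (hP : Realizable H P) : repDead n P = false := by
  rw [Bool.eq_false_iff]
  intro h
  simp only [repDead, sums, List.any_eq_true, Bool.or_eq_true, Nat.blt_eq] at h
  obtain ⟨t, ht, h⟩ := h
  have hb := hP.rep_b t ht; have hc := hP.rep_c t ht; have ha := hP.rep_a t ht
  rw [hn] at hb hc ha
  rcases h with (h | h) | h <;> omega

/-- **`n16DeadL` is sound**: a realisable pattern passes the aligned block-volume law. [folklore] -/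
theorem not_n16DeadL (hn : Fintype.card H = n) {P : List Shape} (hP : Realizable H P) : n16DeadL n P = false := by
  rw [Bool.eq_false_iff]
  intro h
  simp only [n16DeadL, sums, List.any_eq_true, Bool.or_eq_true, Nat.blt_eq] at h
  obtain ⟨t, ht, h⟩ := h
  have ha := hP.n16_a t ht; have hb := hP.n16_b t ht; have hc := hP.n16_c t ht
  rw [hn] at ha hb hc
  rcases h with (h | h) | h <;> omega

omit [Fintype H] in
/-- **The non-minimal branch of `leafOK`** excludes bad patterns. [folklore] -/
theorem not_bad_of_nonminimal {st : St} {P : List Shape} (hI : Inv n st P) (h : Nat.blt (n + st.mm) st.vol = true) : ¬ Bad n H P := by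
  rintro ⟨-, -, hmin⟩
  rw [hI.1, stOf_vol, stOf_mm, Nat.blt_eq] at h
  omega

end Filters

end Summit.MatrixMultiplication.OmegaCensus.KLister
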